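import Summits.KontsevichZagierPeriods.KontsevichZagierPeriods.Theses.FurushoPentagon
import Literature.NumberTheory.Transcendental.DrinfeldAssociatorPentagonProofs
import Literature.NumberTheory.Transcendental.DrinfeldAssociatorIsGroupLikeProofs
import Literature.NumberTheory.Transcendental.MultipleZetaValues

/-!
# `KernelModuloPeriodConjecture` (stmt-KontsevichZagierPeriods-15058), line `Sketch`: the algebraic
# leaf implies Brown's Hoffman-spanning theorem

Cdisprove unit of the crux `KernelModuloPeriodConjecture` (route `FurushoPentagon`). HARDNESS of the
registered stub `stub_associatorHoffmanSpanning` (the algebraic leaf: one universal rational Hoffman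
reduction of every admissible coefficient at every group-like pentagon solution over every reduced
commutative `ℚ`-algebra): evaluated at ONE point — the tree's real Drinfeld associator
`Φ_KZ ∈ ℝ⟨⟨X₀,X₁⟩⟩` (`drinfeldAssociator`: group-like, `drinfeldAssociator_isGroupLike_holds`, and a
pentagon solution, `drinfeldAssociator_pentagon_holds`, both tree THEOREMS; convergent coefficients
`(−1)^{depth s} ζ(s)`, `drinfeldAssociator_binaryWord`) — the leaf puts every real multiple zeta value
in the `ℚ`-span of the Hoffman values of the same weight (`multipleZeta_mem_hoffmanSpan_of_stubA`),
i.e. it proves the spanning half of Brown's theorem [Brown 2012, Thm 1.1], which in the tree is the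
UNPROVED named fact `hoffmanSpan_eq_mzvSpace` (`hoffmanSpan_eq_mzvSpace_of_stubA`). So any proof of the
leaf is, in particular, a new proof of Brown's theorem (with one motivic-Galois-uniform certificate),
and the leaf is NOT implied by Conjecture 1 (it quantifies over all associators, the `GRT` side).

Sources: F. Brown, *Mixed Tate motives over ℤ*, Ann. of Math. 175 (2012), Thm 1.1; M. Hoffman,
J. Algebra 194 (1997); V. Drinfeld, Leningrad Math. J. 2 (1991); H. Furusho, Publ. RIMS 39 (2003),
Prop. 3.2.3.
-/

noncomputable section

namespace Summit.KontsevichZagierPeriods.KernelModuloPeriodConjecture.Negative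

open Literature.NumberTheory.Transcendental

/-- **The algebraic leaf ⇒ every real MZV lies in the Hoffman span of its weight** (the leaf read at
`Φ_KZ`). [cite: Brown2012, Thm 1.1] -/
theorem multipleZeta_mem_hoffmanSpan_of_stubA
    (hA : ∀ s : List ℕ, MZV.IsAdmissible s → ∃ b : List ℕ →₀ ℚ,
      (∀ t ∈ b.support, MZV.IsHoffman t ∧ MZV.weight t = MZV.weight s) ∧
      ∀ (R : Type) [CommRing R] [Algebra ℚ R] [IsReduced R] (φ : NCSeries Bool R),
        NCSeries.IsGroupLike φ → NCSeries.DrinfeldPentagon φ →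
          φ (MZV.binaryWord s) = b.sum (fun t q => q • φ (MZV.binaryWord t)))
    {s : List ℕ} (hs : MZV.IsAdmissible s) :
    multipleZeta s ∈ hoffmanSpan (MZV.weight s) := by
  obtain ⟨b, hb, h⟩ := hA s hs
  have hΦ := h ℝ drinfeldAssociator drinfeldAssociator_isGroupLike_holds drinfeldAssociator_pentagon_holds
  rw [drinfeldAssociator_binaryWord hs] at hΦ
  have hsum : b.sum (fun t q => q • drinfeldAssociator (MZV.binaryWord t)) ∈ hoffmanSpan (MZV.weight s) := by
    unfold Finsupp.sum
    refine Submodule.sum_mem _ fun t ht => ?_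
    obtain ⟨hH, hw⟩ := hb t ht
    show b t • drinfeldAssociator (MZV.binaryWord t) ∈ hoffmanSpan (MZV.weight s)
    rw [drinfeldAssociator_binaryWord hH.isAdmissible]
    refine Submodule.smul_mem _ _ ?_
    have hmem : multipleZeta t ∈ hoffmanSpan (MZV.weight s) :=
      Submodule.subset_span ⟨t, hH, hw, rfl⟩
    have : ((-1 : ℝ) ^ t.length * multipleZeta t) = ((-1 : ℤ) ^ t.length) • multipleZeta t := by
      simp [zsmul_eq_mul]
    rw [this]
    exact zsmul_mem hmem _
  have hζ : multipleZeta s =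
      ((-1 : ℤ) ^ s.length) • b.sum (fun t q => q • drinfeldAssociator (MZV.binaryWord t)) := by
    rw [← hΦ, zsmul_eq_mul, Int.cast_pow, Int.cast_neg, Int.cast_one, ← mul_assoc, ← pow_add,
      ← two_mul, pow_mul]
    simp
  rw [hζ]
  exact zsmul_mem hsum _

/-- **The algebraic leaf ⇒ the tree's named fact `hoffmanSpan_eq_mzvSpace`** (Brown 2012, Thm 1.1:
the Hoffman elements span `𝒵_n` for every `n`; unproved in the tree). [cite: Brown2012, Thm 1.1] -/
theorem hoffmanSpan_eq_mzvSpace_of_stubA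
    (hA : ∀ s : List ℕ, MZV.IsAdmissible s → ∃ b : List ℕ →₀ ℚ,
      (∀ t ∈ b.support, MZV.IsHoffman t ∧ MZV.weight t = MZV.weight s) ∧
      ∀ (R : Type) [CommRing R] [Algebra ℚ R] [IsReduced R] (φ : NCSeries Bool R),
        NCSeries.IsGroupLike φ → NCSeries.DrinfeldPentagon φ →
          φ (MZV.binaryWord s) = b.sum (fun t q => q • φ (MZV.binaryWord t))) :
    hoffmanSpan_eq_mzvSpace := by
  intro n
  refine le_antisymm (hoffmanSpan_le_mzvSpace n) ?_
  refine Submodule.span_le.mpr ?_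
  rintro x ⟨s, hs, hw, rfl⟩
  rw [← hw]
  exact multipleZeta_mem_hoffmanSpan_of_stubA hA hs

end Summit.KontsevichZagierPeriods.KernelModuloPeriodConjecture.Negative

end
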